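import Summits.Parity.BatemanHorn.Theorems.SoloBlindNoLevel
import Literature.NumberTheory.Sieve.AsymptoticSieveForPrimes
import HarnessLib

/-!
# The Friedlander–Iwaniec hypotheses (R1) ∧ (R) fail for `n² + 1` — PROVED

Solo seat `solo-Parity-blind` (summit `Parity`, conjunct `BatemanHorn`), sequel to
`SoloBlindNoLevel.lean`.  The tree types the hypotheses of the Friedlander–Iwaniec asymptotic sieve
for primes (Ann. of Math. 148 (1998), Theorem 1) as
`SieveSequence.FIAsymptoticSieveHypotheses A D δ Δ` (`Literature.NumberTheory.Sieve.AsymptoticSieveForPrimes`):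
among its clauses are (R1) `x^{2/3} < D(x)` and (R) `∑_{d ≤ D(x), d squarefree} |r_d(t)| ≤ A(x)(log x)^{-2^{22}}`
for all `t ≤ x`, eventually in `x`.

* `sqOneSeq_remainder_sum_ge` — the quantitative core, uniform in the level: for every `η > 0` there
  are `c₀ > 0` and `X₀` such that for all `x ≥ X₀` and every `V` with `V + 1 ≥ x^{1/2+η}`,
  `c₀ · X(x) ≤ ∑_{d ≤ V, d squarefree} |R_d(x)|` for the height-indexed sequence `sqOneSeq` of the
  values `n² + 1` (`X(x) = #{n ≥ 1 : n² + 1 ≤ x}`);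
* `sqOneSeq_not_FI_R` — hence for ANY level function `D` with `x^{2/3} < D(x)` eventually and any
  exponent `L ≥ 1`, the bound `∑_{d ≤ D(x), d sqfree} |R_d(x)| ≤ X(x)/(log x)^L` fails for
  arbitrarily large `x`;
* `sqOneSeq_not_FIAsymptoticSieveHypotheses` — so `sqOneSeq` satisfies
  `FIAsymptoticSieveHypotheses D δ Δ` for NO `D, δ, Δ`, the failure being located in (R1) ∧ (R)
  alone (the proof touches no other clause; (1.16) would fail too, trivially, since `n² + 1` need
  not be squarefree, but that is not used).

No `sorry`, no new definitions, standard axioms.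

References.  J. Friedlander, H. Iwaniec, *Asymptotic sieve for primes*, Ann. of Math. 148 (1998),
1041–1065, (R), (R1).  K. Ford, J. Maynard, arXiv:2407.14368 (2024), §1.
-/

noncomputable section

open Finset Real Polynomial Filter Asymptotics
open Literature.NumberTheory.Sieve Literature.NumberTheory.Sieve.Iwaniec1978

namespace Summit.Parity.BatemanHorn.Theorems.SoloBlindLevel

/-- **Quantitative core, uniform in the level.** For every `η > 0` there are `c₀ > 0` and `X₀` with:
for all `x ≥ X₀` and all `V` with `x^{1/2+η} ≤ V + 1`,
`c₀ · X(x) ≤ ∑_{d ≤ V, d squarefree} |R_d(x)|` for `sqOneSeq`. -/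
theorem sqOneSeq_remainder_sum_ge {η : ℝ} (hη : 0 < η) :
    ∃ c₀ : ℝ, 0 < c₀ ∧ ∃ X₀ : ℝ, ∀ x : ℝ, X₀ ≤ x → ∀ V : ℕ, x ^ (1 / 2 + η) ≤ (V : ℝ) + 1 →
      c₀ * (sqCount x : ℝ) ≤ ∑ d ∈ (Icc 1 V).filter Squarefree, |sqOneSeq.remainder d x| := by
  have hirr : Irreducible (quadPoly 1 0 1) := by
    rw [quadPoly_one_zero_one]; exact irreducible_X_sq_add_one_int
  obtain ⟨N₀, hN₀⟩ := quadratic_level_le_half (a := 1) (b := 0) (c := 1) one_pos odd_one hirr hη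
  rw [quadPoly_one_zero_one] at hN₀
  refine ⟨η / (2 * (1 + η)), by positivity,
    max ((N₀ * N₀ + 1 : ℕ) : ℝ) (max ((2 : ℝ) ^ (2 / η)) 4), ?_⟩
  intro x hx V hV
  have hxX₂ : ((N₀ * N₀ + 1 : ℕ) : ℝ) ≤ x := (le_max_left _ _).trans hx
  have hxX₄ : (2 : ℝ) ^ (2 / η) ≤ x := ((le_max_left _ _).trans (le_max_right _ _)).trans hx
  have hx4 : (4 : ℝ) ≤ x := ((le_max_right _ _).trans (le_max_right _ _)).trans hx
  have hx0 : 0 < x := by linarith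
  have hx1 : 1 ≤ x := by linarith
  have hN₀N : N₀ ≤ sqCount x := le_sqCount hxX₂
  have hNle : (sqCount x : ℝ) ≤ x ^ (1 / 2 : ℝ) := sqCount_le_rpow hx0.le
  have hxη : (2 : ℝ) ≤ x ^ (η / 2) := by
    have hne : η ≠ 0 := hη.ne'
    calc (2 : ℝ) = ((2 : ℝ) ^ (2 / η)) ^ (η / 2) := by
          rw [← Real.rpow_mul (by norm_num : (0 : ℝ) ≤ 2), show 2 / η * (η / 2) = 1 by field_simp,
            Real.rpow_one]
      _ ≤ x ^ (η / 2) := Real.rpow_le_rpow (by positivity) hxX₄ (by positivity)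
  have hNV : (sqCount x : ℝ) ^ (1 + η) ≤ (V : ℝ) := by
    have h1 : (sqCount x : ℝ) ^ (1 + η) ≤ x ^ (1 / 2 + η / 2) :=
      calc (sqCount x : ℝ) ^ (1 + η) ≤ (x ^ (1 / 2 : ℝ)) ^ (1 + η) :=
            Real.rpow_le_rpow (by positivity) hNle (by positivity)
        _ = x ^ (1 / 2 + η / 2) := by rw [← Real.rpow_mul hx0.le]; congr 1; ring
    have h2 : x ^ (1 / 2 + η / 2) + 1 ≤ x ^ (1 / 2 + η) := by
      rw [show (1 / 2 + η : ℝ) = (1 / 2 + η / 2) + η / 2 by ring,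
        Real.rpow_add hx0 (1 / 2 + η / 2) (η / 2)]
      have h3 : (1 : ℝ) ≤ x ^ (1 / 2 + η / 2) := Real.one_le_rpow hx1 (by positivity)
      nlinarith [hxη, h3]
    linarith
  have hadm := sqCount_admissible hx0.le
  have hlow := hN₀ (sqCount x) hN₀N V hNV x hadm
  have hsub : (Ioc (4 * sqCount x) V).filter Nat.Prime ⊆ (Icc 1 V).filter Squarefree := by
    intro p hp
    rw [Finset.mem_filter, Finset.mem_Ioc] at hp
    rw [Finset.mem_filter, Finset.mem_Icc]
    exact ⟨⟨hp.2.one_lt.le, hp.1.2⟩, hp.2.prime.squarefree⟩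
  have hle : ∑ p ∈ (Ioc (4 * sqCount x) V).filter Nat.Prime,
        |(polyAPSeq (X ^ 2 + 1 : ℤ[X]) (sqCount x) 1 0).remainder p x| ≤
      ∑ d ∈ (Icc 1 V).filter Squarefree, |sqOneSeq.remainder d x| := by
    simp_rw [← sqOneSeq_remainder]
    exact Finset.sum_le_sum_of_subset_of_nonneg hsub fun _ _ _ => abs_nonneg _
  linarith

/-- **(R1) ∧ (R) fail for `n² + 1`.** For any level function `D` with `x^{2/3} < D(x)` eventually
and any `L ≥ 1`, the remainder bound `∑_{d ≤ D(x), d squarefree} |R_d(x)| ≤ X(x)/(log x)^L` fails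
for arbitrarily large `x`. -/
theorem sqOneSeq_not_FI_R {D : ℝ → ℝ} (hR1 : ∀ᶠ x : ℝ in atTop, x ^ (2 / 3 : ℝ) < D x) {L : ℕ}
    (hL : 1 ≤ L) :
    ¬ ∀ᶠ x : ℝ in atTop, ∑ d ∈ (Icc 1 ⌊D x⌋₊).filter Squarefree, |sqOneSeq.remainder d x| ≤
        sqOneSeq.size x / Real.log x ^ L := by
  intro hR
  obtain ⟨c₀, hc₀, X₀, hX₀⟩ := sqOneSeq_remainder_sum_ge (η := 1 / 6) (by norm_num)
  obtain ⟨x₁, hx₁⟩ := Filter.eventually_atTop.mp (hR1.and hR)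
  obtain ⟨x, hxx₁, hxX₀, hxE, hx4⟩ :
      ∃ x : ℝ, x₁ ≤ x ∧ X₀ ≤ x ∧ Real.exp (1 / c₀ + 1) ≤ x ∧ 4 ≤ x :=
    ⟨max (max x₁ X₀) (max (Real.exp (1 / c₀ + 1)) 4), (le_max_left _ _).trans (le_max_left _ _),
      (le_max_right _ _).trans (le_max_left _ _), (le_max_left _ _).trans (le_max_right _ _),
      (le_max_right _ _).trans (le_max_right _ _)⟩
  obtain ⟨hD, hS⟩ := hx₁ x hxx₁
  have hV : x ^ (1 / 2 + 1 / 6 : ℝ) ≤ (⌊D x⌋₊ : ℝ) + 1 := by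
    rw [show (1 / 2 + 1 / 6 : ℝ) = 2 / 3 by norm_num]
    exact (hD.trans (Nat.lt_floor_add_one (D x))).le
  have hlow := hX₀ x hxX₀ ⌊D x⌋₊ hV
  rw [sqOneSeq_size] at hS
  have hN1 : (1 : ℝ) ≤ sqCount x := by
    exact_mod_cast one_le_sqCount (by linarith : (2 : ℝ) ≤ x)
  have hN0 : (0 : ℝ) < sqCount x := by linarith
  have hlogx : 1 / c₀ + 1 ≤ Real.log x := by
    rw [← Real.log_exp (1 / c₀ + 1)]; exact Real.log_le_log (Real.exp_pos _) hxE
  have hc₀' : 0 < 1 / c₀ := by positivity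
  have hlog1 : 1 ≤ Real.log x := by linarith
  have hlogpos : 0 < Real.log x := by linarith
  have hpow : Real.log x ≤ Real.log x ^ L :=
    calc Real.log x = Real.log x ^ 1 := (pow_one _).symm
      _ ≤ Real.log x ^ L := pow_le_pow_right₀ hlog1 hL
  have hS' : ∑ d ∈ (Icc 1 ⌊D x⌋₊).filter Squarefree, |sqOneSeq.remainder d x| ≤
      (sqCount x : ℝ) / Real.log x :=
    hS.trans (div_le_div_of_nonneg_left (Nat.cast_nonneg _) hlogpos hpow)
  have h1 : c₀ * (sqCount x : ℝ) ≤ (sqCount x : ℝ) / Real.log x := hlow.trans hS'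
  rw [le_div_iff₀ hlogpos] at h1
  have h2 : c₀ * Real.log x * (sqCount x : ℝ) ≤ 1 * (sqCount x : ℝ) := by linarith
  have h3 : c₀ * Real.log x ≤ 1 := le_of_mul_le_mul_right h2 hN0
  have h4 : c₀ * (1 / c₀ + 1) = 1 + c₀ := by field_simp
  have h5 : c₀ * (1 / c₀ + 1) ≤ c₀ * Real.log x := mul_le_mul_of_nonneg_left hlogx hc₀.le
  linarith

/-- **Corollary: `n² + 1` satisfies the Friedlander–Iwaniec hypotheses for NO level / range
functions `D, δ, Δ`** — the failure located in (R1) ∧ (R). -/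
theorem sqOneSeq_not_FIAsymptoticSieveHypotheses (D δ Δ : ℝ → ℝ) :
    ¬ sqOneSeq.FIAsymptoticSieveHypotheses D δ Δ := by
  intro h
  have hR1 : ∀ᶠ x : ℝ in atTop, x ^ (2 / 3 : ℝ) < D x :=
    h.2.2.2.2.2.2.1.mono fun x hx => hx.1
  have hR : ∀ᶠ x : ℝ in atTop, ∑ d ∈ (Icc 1 ⌊D x⌋₊).filter Squarefree, |sqOneSeq.remainder d x| ≤
      sqOneSeq.size x / Real.log x ^ SieveSequence.fiLogSaving :=
    h.2.2.2.2.2.2.2.1.mono fun x hx => hx x le_rfl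
  exact sqOneSeq_not_FI_R hR1 (L := SieveSequence.fiLogSaving)
    (by rw [SieveSequence.fiLogSaving_eq]; norm_num) hR

end Summit.Parity.BatemanHorn.Theorems.SoloBlindLevel

end
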